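import Literature.AlgebraicGeometry.Frobenioids.Cor411iiiAtSetting
import Literature.AlgebraicGeometry.Frobenioids.DivisorMonoidIsoDescentFormulas
import Literature.AlgebraicGeometry.Frobenioids.Thm49Assembly
import Literature.AlgebraicGeometry.Frobenioids.PerfectionBiratNormalized
import Literature.AlgebraicGeometry.Frobenioids.BirationalizationIstrComparison
import Literature.AlgebraicGeometry.Frobenioids.UnitTrivializationProp48iiiUnconditional
import Literature.AlgebraicGeometry.Frobenioids.ModelFrobenioidModelType
import HarnessLib

/-!
# Frobenioids I, Corollary 4.11 (iii)/(iv) for general Frobenioids over bases of FSM-type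

Mochizuki, *The geometry of Frobenioids I: the general theory*, Kyushu J. Math. **62** (2008)
293–400, kurims text: Cor. 4.11 (iii), (iv) p. 92, proof p. 94 ("assertion (iii) follows formally from
assertion (ii); Theorem 4.9 … (iv) … by concatenating assertions (ii), (iii), with the fact that `Ψ`
preserves Frobenius degrees") [cite: MochizukiFrdI2008, Cor. 4.11 (iii) p.92]; Theorem 3.4 (ii)(iii) p. 62;
Theorem 4.9 pp. 88–90.

PROOF-ONLY file (seat abc-iut-L1-t14, rows `FrdI:Cor4.11(iii)`, `FrdI:Cor4.11(iv)`; continuation of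
`Cor411iiiAtSetting.lean` and `DivisorMonoidIsoDescentFormulas.lean`). Everything BY NAME, no re-proving:

* `FrdI.cor411iii_of_cor411ii_of_isOfFSMType` — the typed Cor. 4.11 (iii) for GENERAL Frobenioids
  `C_i → F_{Φ_i}` (perf-factorial `Φ_i`, bases of FSM-type — the cell's standing route for Thm. 3.4
  (ii)/(iii) —, `C₁` of rational type read at THE birationalization and THE support predicate) from the
  typed Cor. 4.11 (ii) for `Ψ` ALONE: the Thm. 4.9 input of seat abc-iut-L1-d6's
  `cor411iii_of_cor411ii_of_thm49` is DISCHARGED by seat abc-iut-w4-d109's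
  `FrdI.T49.thm49_ofFunctor_of_isOfFSMType` (the typed Thm. 4.9, proved end-to-end);
* `FrdI.T49.exists_divisorMonoidIsoOver_div_of_isOfFSMType` — Thm. 4.9 at the C-level WITH the Div clause
  `Ψ^Φ_A(Div φ) = Div(Ψ φ)` on ALL arrows (standard type, FSM bases, non-group-like, rational at the
  constructions): abc-iut-w4-d109's construction of `thm49_ofFunctor_of_isOfFSMType` verbatim with the
  equation-carrying descents of `DivisorMonoidIsoDescentFormulas.lean`;
* `FrdI.cor411iv_of_cor411ii_of_isOfFSMType` / `…_of_isOfGroupLikeType` — the typed Cor. 4.11 (iv) for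
  GENERAL Frobenioids over FSM bases from the typed Cor. 4.11 (ii) alone (non-group-like case; in the
  group-like case also from "`Ψ` preserves Frobenius degrees", Thm. 3.4 (iv), the `Φ_i` being trivial);
* `PreFrobenioid.isFrobenioid_perfection_istr` / `isFrobenioid_birat_perfection_istr` — the two residual
  hypotheses of seat abc-iut-L1-d6's general `cor411ii_of_isOfFSMType` ("`(C^istr)^pf`, `((C^istr)^pf)^birat`
  are Frobenioids") DISCHARGED from Prop. 3.2 (iii) and from "birationally Frobenius-normalized type"
  (Def. 4.5 (iii)(a); Prop. 4.4 (ii) in the 2024 form, transported along `C^istr → C` and `(−)^pf`);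
Hypotheses: Frobenioids with perf-factorial `Φ_i` (§4); bases of FSM-type (the cell's route to Thm. 3.4
(ii)(iii)); "`C₁` of rational type" read at THE birationalization and THE support predicate `PrimarySupp`
(Def. 4.5 (ii)(iii), Def. 2.4 (i)(d)); "birationally Frobenius-normalized type" (Def. 4.5 (iii)(a)) for the
birationalization lemma; the typed Cor. 4.11 (ii) for `Ψ` (`h2`; its general closer is seat abc-iut-L1-d6's
`cor411ii_of_isOfFSMType`, whose two residual hypotheses are the lemmas above). The parameters
`R_i : RSParams` are arbitrary. No new definitions; nothing of the paper is restated or strengthened; nothing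
here is specific to the abc programme and no side is taken on [IUTchIII] Cor. 3.12.
-/

namespace Literature.AlgebraicGeometry.Frobenioids

open CategoryTheory Opposite

universe w v v' u u'

namespace PreFrobenioid

variable {D : Type u} [Category.{v} D] {Φ : Dᵒᵖ ⥤ CommMonCat.{w}} {C : Type u'} [Category.{v'} C]
  {F : C ⥤ ElemFrobenioid Φ}

/-- **"`(C^istr)^pf` is a Frobenioid"** (Prop. 3.2 (iii) for the isotropic part `C^istr`, which is of
isotropic — hence Frobenius-isotropic — type; seats abc-iut-L1-d1/d9's `Perfection.isFrobenioid`): the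
hypothesis `hPf` of seat abc-iut-L1-d6's `cor411ii_of_isOfFSMType`, discharged.
[cite: MochizukiFrdI2008, Prop. 3.2 (iii) p.58] -/
theorem isFrobenioid_perfection_istr (hF : IsFrobenioid F) :
    IsFrobenioid (Perfection.ops (isFrobenioid_istr hF)).toFunctor :=
  Perfection.isFrobenioid (isFrobenioid_istr hF)
    (FrdI.T42.isFrobeniusIsotropic_of_isOfIsotropicType (isFrobenioid_istr hF) isOfIsotropicType_istr)

set_option backward.isDefEq.respectTransparency false in
/-- **"`((C^istr)^pf)^birat` is a Frobenioid" for `C` of birationally Frobenius-normalized type** (Def. 4.5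
(i), at THE birationalization): Prop. 4.4 (ii) in the author's 2024 form (`Birat.isFrobenioid_general`, seat
abc-iut-L6-t20) at the perfection of the isotropic part, its hypothesis transported along
`(C^istr)^birat → C^birat` (seat abc-iut-L6-t8's `isFrobeniusNormalized_istr_of`) and along the perfection
(Prop. 5.5 (iii), seat abc-iut-L6-t6 lineage's `isOfBiratFrobeniusNormalizedType_biratData_perfection`): the
hypothesis `hB` of seat abc-iut-L1-d6's `cor411ii_of_isOfFSMType`, discharged from print's "rationally standard
(a): birationally Frobenius-normalized". [cite: MochizukiFrdI2008, Def. 4.5 (iii) p.86] -/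
theorem isFrobenioid_birat_perfection_istr (hF : IsFrobenioid F)
    (hnb : PreFrobenioidData.IsOfBiratFrobeniusNormalizedType (biratData hF (hasBiratSquares_of_isFrobenioid hF)))
    (hPf : IsFrobenioid (Perfection.ops (isFrobenioid_istr hF)).toFunctor) :
    IsFrobenioid (Birat.toElemZero hPf (hasBiratSquares_of_isFrobenioid hPf)) := by
  have hI := isFrobenioid_istr hF
  have hsqI := hasBiratSquares_of_isFrobenioid hI
  -- `C^istr` is of birationally Frobenius-normalized type; `(C^istr)^birat` is a Frobenioid
  have hbfnI : ∀ A : Istr F, IsBiratFrobeniusNormalized (istrFunctor F) hI hsqI A := fun A =>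
    (Birat.isFrobeniusNormalized_toElemZero_iff _ _ _).mp
      (Birat.isFrobeniusNormalized_istr_of (hF := hF) (hsq := hasBiratSquares_of_isFrobenioid hF) (hsq' := hsqI) A
        ((PreFrobenioidData.ofFunctor_isFrobeniusNormalized _ _).mp (hnb.obj A.obj)))
  have hnbI : PreFrobenioidData.IsOfBiratFrobeniusNormalizedType (biratData hI hsqI) :=
    ⟨fun A => (isBiratFrobeniusNormalized_iff_biratData A).mp (hbfnI A)⟩
  have hBiI : IsFrobenioid (biratOps hI hsqI).toFunctor := isFrobenioid_biratOps_toFunctor_general hI hsqI hbfnI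
  -- transport to the perfection (Prop. 5.5 (iii)), then Prop. 4.4 (ii) (2024) there
  have hnbP := PerfectionBirat.isOfBiratFrobeniusNormalizedType_biratData_perfection hPf
    (hasBiratSquares_of_isFrobenioid hPf) hBiI hnbI
  exact Birat.isFrobenioid_general hPf _ fun X => Birat.isBiratFrobeniusNormalized_of_obj hPf _ X (hnbP.obj X)

end PreFrobenioid

namespace FrdI

open PreFrobenioid

variable {D₁ : Type u} [Category.{v} D₁] {Φ₁ : D₁ᵒᵖ ⥤ CommMonCat.{w}} {C₁ : Type u'} [Category.{v'} C₁]
  {D₂ : Type u} [Category.{v} D₂] {Φ₂ : D₂ᵒᵖ ⥤ CommMonCat.{w}} {C₂ : Type u'} [Category.{v'} C₂]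
  {F₁ : C₁ ⥤ ElemFrobenioid Φ₁} {F₂ : C₂ ⥤ ElemFrobenioid Φ₂}

/-- **[FrdI] Cor. 4.11 (iii) AS TYPED from Cor. 4.11 (ii) alone, for general Frobenioids over bases of
FSM-type** ("assertion (iii) follows formally from assertion (ii); Theorem 4.9", p. 94): for Frobenioids
`C_i → F_{Φ_i}` with perf-factorial `Φ_i` over bases of FSM-type and `C₁` of rational type at THE
birationalization / support (`hrat₁`, the "rational" conjunct of "rationally standard" read at the
constructions), the typed Cor. 4.11 (ii) for `Ψ` implies the typed Cor. 4.11 (iii): Thm. 4.9 is seat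
abc-iut-w4-d109's `FrdI.T49.thm49_ofFunctor_of_isOfFSMType`, the descent `D^* ⥲ D` is seat abc-iut-L1-d6's
`cor411iii_of_cor411ii_of_thm49`. [cite: MochizukiFrdI2008, Cor. 4.11 (iii) p.92] -/
theorem cor411iii_of_cor411ii_of_isOfFSMType (hF₁ : IsFrobenioid F₁) (hF₂ : IsFrobenioid F₂)
    (hD₁ : IsOfFSMType D₁) (hD₂ : IsOfFSMType D₂)
    (hpf₁ : Objectwise (fun M _ => IsPerfFactorial M) Φ₁) (hpf₂ : Objectwise (fun M _ => IsPerfFactorial M) Φ₂)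
    (hrat₁ : ∀ A : C₁, PreFrobenioidData.IsRational
      (biratData hF₁ (hasBiratSquares_of_isFrobenioid hF₁))
      (S := PreFrobenioidData.ofFunctor Φ₁ F₁) (fun a 𝔭 => PrimarySupp a 𝔭) A)
    (Ψ : C₁ ≌ C₂) (R₁ : (PreFrobenioidData.ofFunctor Φ₁ F₁).RSParams)
    (R₂ : (PreFrobenioidData.ofFunctor Φ₂ F₂).RSParams)
    (h2 : (PreFrobenioidData.ofFunctor Φ₁ F₁).Cor411ii (PreFrobenioidData.ofFunctor Φ₂ F₂) Ψ) :
    (PreFrobenioidData.ofFunctor Φ₁ F₁).Cor411iii (PreFrobenioidData.ofFunctor Φ₂ F₂) Ψ R₁ R₂ :=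
  PreFrobenioidData.cor411iii_of_cor411ii_of_thm49 _ _ Ψ R₁ R₂ (exists_base_iso_of_isFrobenioid F₁ hF₁)
    (exists_preSteps_of_base_iso F₁ hF₁) (fun A _ f => exists_arrow_over_base F₁ hF₁ A f) h2
    (FrdI.T49.thm49_ofFunctor_of_isOfFSMType hF₁ hF₂ hD₁ hD₂ hpf₁ hpf₂ hrat₁ Ψ R₁ R₂)

/-- **[FrdI] Thm. 4.9 at the C-level WITH the Div clause of its construction** ("determines an isomorphism of
monoids `Φ₁(A₁) ⥲ Φ₂(A₂)` which is functorial in `A₁`", p. 89; the `Ψ^Φ` is built from the right-hand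
isomorphisms of Thm. 4.2 (iii), `Div(Ψ φ) = Ψ^Φ(Div φ)` for pre-steps `φ`): for Frobenioids `C_i → F_{Φ_i}`
of standard type with perf-factorial `Φ_i` over bases of FSM-type, `C₁` not of group-like type and of rational
type at THE birationalization / support, there is an isomorphism of functors `Ψ^Φ : Φ₁ ⥲ Φ₂` over `Ψ`
with `Ψ^Φ_A(Div φ) = Div(Ψ φ)` for EVERY arrow `φ : A → B` of `C₁`. Construction = seat abc-iut-w4-d109's
`FrdI.T49.thm49_ofFunctor_of_isOfFSMType` VERBATIM (isotropifications `Ψ^istr`, perfections `Ψ^pf`, the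
setting `FrdI.T42.setting_perfection`, Rmk. 4.5.1 / Prop. 5.5 (iii) rationality transfers, Thm. 4.9 at the
perfections `exists_thm49_compat_perfect_primarySupp`), with the two descents taken in their
equation-carrying form (`exists_divisorMonoidIsoOver_of_perfection`, `exists_divisorMonoidIsoOver_of_isotropic`,
`iso_div_of_agree_isotropic`, this seat) and the passage from pre-steps to all arrows
(`DivisorMonoidIsoOver.iso_div_of_preSteps`; Thm. 3.4 (iii) over FSM bases:
`FrdI.isFrobeniusType_map_quasiIsotropic`, `FrdI.isPullbackMorphism_map_quasiIsotropic`).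
[cite: MochizukiFrdI2008, Thm. 4.9 p.89] -/
theorem T49.exists_divisorMonoidIsoOver_div_of_isOfFSMType (hF₁ : IsFrobenioid F₁) (hF₂ : IsFrobenioid F₂)
    (hD₁ : IsOfFSMType D₁) (hD₂ : IsOfFSMType D₂)
    (hpf₁ : Objectwise (fun M _ => IsPerfFactorial M) Φ₁) (hpf₂ : Objectwise (fun M _ => IsPerfFactorial M) Φ₂)
    (hs₁ : (PreFrobenioidData.ofFunctor Φ₁ F₁).IsOfStandardType)
    (hs₂ : (PreFrobenioidData.ofFunctor Φ₂ F₂).IsOfStandardType)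
    (hng : ¬ (PreFrobenioidData.ofFunctor Φ₁ F₁).IsOfGroupLikeType)
    (hrat₁ : ∀ A : C₁, PreFrobenioidData.IsRational
      (biratData hF₁ (hasBiratSquares_of_isFrobenioid hF₁))
      (S := PreFrobenioidData.ofFunctor Φ₁ F₁) (fun a 𝔭 => PrimarySupp a 𝔭) A)
    (Ψ : C₁ ≌ C₂) :
    ∃ E : (PreFrobenioidData.ofFunctor Φ₁ F₁).DivisorMonoidIsoOver (PreFrobenioidData.ofFunctor Φ₂ F₂) Ψ,
      ∀ ⦃A B : C₁⦄ (φ : A ⟶ B), E.iso A (Div F₁ φ) = Div F₂ (Ψ.functor.map φ) := by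
  have hP₁ := hF₁.isPreFrobenioid
  have hP₂ := hF₂.isPreFrobenioid
  have hq₁ := hs₁.quasiIsotropic
  have hq₂ := hs₂.quasiIsotropic
  have hnd₁ : IsNonDilatingOn Φ₁ := FrdI.isNonDilatingOn_of_ofFunctor hs₁.nonDilating
  have hnd₂ : IsNonDilatingOn Φ₂ := FrdI.isNonDilatingOn_of_ofFunctor hs₂.nonDilating
  -- non-group-like objects `N₁`, `Ψ N₁`
  obtain ⟨N₁, hN₁⟩ : ∃ A : C₁, ¬ IsGroupLikeObj F₁ A := by
    by_contra h
    exact hng ⟨fun A => (PreFrobenioidData.ofFunctor_isGroupLikeObj F₁ A).2 (not_exists_not.mp h A)⟩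
  have hN₂ : ¬ IsGroupLikeObj F₂ (Ψ.functor.obj N₁) := fun h =>
    hN₁ (FrdI.isGroupLikeObj_of_isBaseIso' hP₁ (Ψ.unitIso.app N₁).hom (isBaseIso_of_isIso F₁ _)
      (FrdI.isGroupLikeObj_map_of_quasiIsotropic_of_isOfFSMType hF₂ hF₁ hq₂ hq₁ hD₂ Ψ.symm h))
  -- (1) the isotropifications and `Ψ^istr` (Thm. 3.4 (i); Rmk. 4.5.1)
  haveI : (isotropicObjects F₂).IsClosedUnderIsomorphisms := ⟨fun e hX => IsIsotropic.of_iso hP₂ e.symm hX⟩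
  have hinvImg := FrdI.isotropicObjects_inverseImage hF₁ hq₁ hq₂ Ψ
  let Ψi : Istr F₁ ≌ Istr F₂ := Ψ.congrFullSubcategory hinvImg
  have hI₁ := isFrobenioid_istr hF₁
  have hI₂ := isFrobenioid_istr hF₂
  have hsI₁ := isOfStandardType_istr hF₁ hs₁
  have hsI₂ := isOfStandardType_istr hF₂ hs₂
  have hNI₁ := T49.not_isGroupLikeObj_hullIstr hF₁ hN₁
  have hNI₂ := T49.not_isGroupLikeObj_hullIstr hF₂ hN₂
  have hΨi : IsFrobeniusCompatible (istrFunctor F₁) (istrFunctor F₂) Ψi.functor :=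
    FrdI.T42.isFrobeniusCompatible_of_isOfFSMType Ψi hI₁ hI₂ hsI₁.quasiIsotropic hsI₂.quasiIsotropic
      hnd₁ hnd₂ hD₁ hD₂ hNI₁ hNI₂
  have hinvI : ∀ ⦃X Y : Istr F₂⦄ (g : X ⟶ Y), IsPreStep (istrFunctor F₂) g →
      IsPreStep (istrFunctor F₁) (Ψi.inverse.map g) :=
    fun X Y g hg => FrdI.isPreStep_map_of_quasiIsotropic_of_isOfFSMType hI₂ hI₁ hsI₂.quasiIsotropic
      hsI₁.quasiIsotropic hD₁ Ψi.symm hg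
  -- (2) the perfections `(C_i^istr)^pf` and the setting of the proof of Thm. 4.2 there
  have hPf₁ := PreFrobenioid.Perfection.isFrobenioid hI₁
    (FrdI.T42.isFrobeniusIsotropic_of_isOfIsotropicType hI₁ isOfIsotropicType_istr)
  have hPf₂ := PreFrobenioid.Perfection.isFrobenioid hI₂
    (FrdI.T42.isFrobeniusIsotropic_of_isOfIsotropicType hI₂ isOfIsotropicType_istr)
  haveI := PreFrobenioid.Perfection.map_isEquivalence (hF₁ := hI₁) (hF₂ := hI₂) Ψi hΨi
  have S := FrdI.T42.setting_perfection Ψi hI₁ hI₂ hPf₁ hPf₂ isOfIsotropicType_istr isOfIsotropicType_istr hpf₁ hpf₂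
    hsI₁.nonDilating hsI₂.nonDilating hD₁ hD₂ hNI₁ hNI₂ hΨi
  have hndp₂ : IsNonDilatingOn (PreFrobenioid.Perfection.ops hI₂).monFunctor :=
    FrdI.isNonDilatingOn_of_ofFunctor (F := (PreFrobenioid.Perfection.ops hI₂).toFunctor)
      (PreFrobenioid.Perfection.isNonDilatingOn_ops hI₂ hsI₂.nonDilating)
  -- Rmk. 4.5.1 / Prop. 5.5 (iii): rationality of `C₁^istr`, `(C₁^istr)^pf`
  have hratI : ∀ A : Istr F₁, PreFrobenioidData.IsRational
      (biratData hI₁ (hasBiratSquares_of_isFrobenioid hI₁))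
      (S := PreFrobenioidData.ofFunctor Φ₁ (istrFunctor F₁)) (fun a 𝔭 => PrimarySupp a 𝔭) A :=
    fun A => isRational_istr_of hF₁ hrat₁ A
  have hratP : ∀ ⦃X : PreFrobenioid.Perfection hI₁⦄,
      IsUniversallyDivFrobeniusTrivial (PreFrobenioid.Perfection.ops hI₁).toFunctor X →
        PreFrobenioidData.IsRational (biratData S.isFrobenioid₁ (hasBiratSquares_of_isFrobenioid S.isFrobenioid₁))
          (S := PreFrobenioidData.ofFunctor _ (PreFrobenioid.Perfection.ops hI₁).toFunctor) (fun a 𝔭 => PrimarySupp a 𝔭) X :=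
    fun X _ => PreFrobenioid.Perfection.isRational_perfection_of hI₁ hPf₁ hratI X
  -- (3) Thm. 4.9 at the perfect-isotropic level, with the Div clause on pre-steps
  obtain ⟨E', -, -, hE', -⟩ := T49.exists_thm49_compat_perfect_primarySupp S hndp₂ hratP
  -- (4) descent to `C_i^istr` WITH the Div clause
  obtain ⟨EI, -, hEI⟩ := T49.exists_divisorMonoidIsoOver_of_perfection hI₁ hI₂ Ψi hΨi hinvI E'
    (fun X Y f hf => hE' f hf)
  -- (5) extension along the isotropic hulls, agreeing with `EI` on isotropic objects
  have hhull : ∀ ⦃A B : C₁⦄ (h : A ⟶ B), IsIsotropicHull F₁ h → IsIsotropicHull F₂ (Ψ.functor.map h) :=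
    fun A B h hh => FrdI.isIsotropicHull_map hF₁ hF₂ hq₁ hq₂ Ψ hh
  obtain ⟨E, hE⟩ := T49.exists_divisorMonoidIsoOver_of_isotropic F₁ F₂ Ψ hF₁ hhull (fun A hA => EI.iso ⟨A, hA⟩)
    (fun A B hA hB φ x => EI.natural (A := (⟨A, hA⟩ : Istr F₁)) (B := ⟨B, hB⟩) (ObjectProperty.homMk φ) x)
  have hEpre : ∀ ⦃A B : C₁⦄ (φ : A ⟶ B), IsPreStep F₁ φ → E.iso A (Div F₁ φ) = Div F₂ (Ψ.functor.map φ) :=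
    T49.iso_div_of_agree_isotropic F₁ F₂ Ψ hF₁ hhull (fun A hA => EI.iso ⟨A, hA⟩)
      (fun A B hA hB φ hφ => hEI (A := (⟨A, hA⟩ : Istr F₁)) (B := ⟨B, hB⟩) (ObjectProperty.homMk φ) hφ) E hE
  -- (6) from pre-steps to all arrows (Def. 1.3 (iv)(a); Thm. 3.4 (iii) over FSM bases)
  exact ⟨E, E.iso_div_of_preSteps hF₁ hF₂
    (fun _ _ φ hφ => FrdI.isFrobeniusType_map_quasiIsotropic hF₁ hF₂ hq₁ hq₂ hD₁ hD₂ hnd₁ hnd₂ Ψ hN₁ hN₂ hφ)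
    (fun _ _ φ hφ => FrdI.isPullbackMorphism_map_quasiIsotropic hF₁ hF₂ hq₁ hq₂ hD₁ hD₂ hnd₁ hnd₂ Ψ hN₁ hN₂ hφ)
    hEpre⟩

/-- **[FrdI] Cor. 4.11 (iv) AS TYPED from Cor. 4.11 (ii), for general Frobenioids over bases of FSM-type,
non-group-like case** ("by concatenating assertions (ii), (iii), with the fact that `Ψ` preserves Frobenius
degrees [cf. Theorem 3.4, (iii)]", p. 94): for Frobenioids `C_i → F_{Φ_i}` with perf-factorial `Φ_i` over
bases of FSM-type, `C₁` not of group-like type and of rational type at THE birationalization / support, the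
typed Cor. 4.11 (ii) for `Ψ` implies the typed Cor. 4.11 (iv): `Ψ^Φ` with its Div clause is
`T49.exists_divisorMonoidIsoOver_div_of_isOfFSMType`, `Ψ` preserves Frobenius degrees by Thm. 3.4 (iii)
(`FrdI.degFr_map`), the descent and concatenation are seat abc-iut-L1-d6's `cor411iv_of_cor411ii`. (The
group-like case — `Φ_i` trivial — is `cor411iv_of_cor411ii_of_isOfGroupLikeType`.)
[cite: MochizukiFrdI2008, Cor. 4.11 (iv) p.92] -/
theorem cor411iv_of_cor411ii_of_isOfFSMType (hF₁ : IsFrobenioid F₁) (hF₂ : IsFrobenioid F₂)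
    (hD₁ : IsOfFSMType D₁) (hD₂ : IsOfFSMType D₂)
    (hpf₁ : Objectwise (fun M _ => IsPerfFactorial M) Φ₁) (hpf₂ : Objectwise (fun M _ => IsPerfFactorial M) Φ₂)
    (hng : ¬ (PreFrobenioidData.ofFunctor Φ₁ F₁).IsOfGroupLikeType)
    (hrat₁ : ∀ A : C₁, PreFrobenioidData.IsRational
      (biratData hF₁ (hasBiratSquares_of_isFrobenioid hF₁))
      (S := PreFrobenioidData.ofFunctor Φ₁ F₁) (fun a 𝔭 => PrimarySupp a 𝔭) A)
    (Ψ : C₁ ≌ C₂) (R₁ : (PreFrobenioidData.ofFunctor Φ₁ F₁).RSParams)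
    (R₂ : (PreFrobenioidData.ofFunctor Φ₂ F₂).RSParams)
    (h2 : (PreFrobenioidData.ofFunctor Φ₁ F₁).Cor411ii (PreFrobenioidData.ofFunctor Φ₂ F₂) Ψ) :
    (PreFrobenioidData.ofFunctor Φ₁ F₁).Cor411iv (PreFrobenioidData.ofFunctor Φ₂ F₂) Ψ R₁ R₂ := by
  intro hs hR₁ hR₂
  have hs₁ := hs.standard.1
  have hs₂ := hs.standard.2
  obtain ⟨N₁, hN₁⟩ : ∃ A : C₁, ¬ IsGroupLikeObj F₁ A := by
    by_contra h
    exact hng ⟨fun A => (PreFrobenioidData.ofFunctor_isGroupLikeObj F₁ A).2 (not_exists_not.mp h A)⟩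
  have hN₂ : ¬ IsGroupLikeObj F₂ (Ψ.functor.obj N₁) := fun h =>
    hN₁ (FrdI.isGroupLikeObj_of_isBaseIso' hF₁.isPreFrobenioid (Ψ.unitIso.app N₁).hom (isBaseIso_of_isIso F₁ _)
      (FrdI.isGroupLikeObj_map_of_quasiIsotropic_of_isOfFSMType hF₂ hF₁ hs₂.quasiIsotropic hs₁.quasiIsotropic
        hD₂ Ψ.symm h))
  obtain ⟨E, hdiv⟩ := T49.exists_divisorMonoidIsoOver_div_of_isOfFSMType hF₁ hF₂ hD₁ hD₂ hpf₁ hpf₂ hs₁ hs₂ hng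
    hrat₁ Ψ
  exact PreFrobenioidData.cor411iv_of_cor411ii _ _ Ψ R₁ R₂ (exists_base_iso_of_isFrobenioid F₁ hF₁)
    (exists_preSteps_of_base_iso F₁ hF₁) (fun A _ f => exists_arrow_over_base F₁ hF₁ A f) h2 E hdiv
    (fun A B φ => FrdI.degFr_map hF₁ hF₂ hs₁.quasiIsotropic hs₂.quasiIsotropic hD₁ hD₂
      (FrdI.isNonDilatingOn_of_ofFunctor hs₁.nonDilating) (FrdI.isNonDilatingOn_of_ofFunctor hs₂.nonDilating)
      Ψ hN₁ hN₂ φ)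
    hs hR₁ hR₂

/-- **[FrdI] Cor. 4.11 (iv) AS TYPED from Cor. 4.11 (ii) and Thm. 3.4 (iv), group-like case** ("Theorem
4.9 is vacuous if `C₁`, `C₂` are of group-like type", p. 89: all `Φ_i(A)` are trivial, so `Ψ^Φ` and its Div
clause are trivial; "`Ψ` preserves Frobenius degrees" = the clause "`Ψ^{ℕ≥1}` is the identity" of Thm. 3.4
(iv), a named input here). [cite: MochizukiFrdI2008, Cor. 4.11 (iv) p.92] -/
theorem cor411iv_of_cor411ii_of_isOfGroupLikeType (hF₁ : IsFrobenioid F₁) (Ψ : C₁ ≌ C₂)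
    (hg₁ : (PreFrobenioidData.ofFunctor Φ₁ F₁).IsOfGroupLikeType)
    (hg₂ : (PreFrobenioidData.ofFunctor Φ₂ F₂).IsOfGroupLikeType)
    (R₁ : (PreFrobenioidData.ofFunctor Φ₁ F₁).RSParams) (R₂ : (PreFrobenioidData.ofFunctor Φ₂ F₂).RSParams)
    (h2 : (PreFrobenioidData.ofFunctor Φ₁ F₁).Cor411ii (PreFrobenioidData.ofFunctor Φ₂ F₂) Ψ)
    (hdeg : PreFrobenioidData.PreservesDegFr (PreFrobenioidData.ofFunctor Φ₁ F₁) (PreFrobenioidData.ofFunctor Φ₂ F₂) Ψ) :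
    (PreFrobenioidData.ofFunctor Φ₁ F₁).Cor411iv (PreFrobenioidData.ofFunctor Φ₂ F₂) Ψ R₁ R₂ := by
  obtain ⟨E⟩ := T49.nonempty_divisorMonoidIsoOver_of_isOfGroupLikeType F₁ F₂ Ψ hg₁ hg₂
  exact PreFrobenioidData.cor411iv_of_cor411ii _ _ Ψ R₁ R₂ (exists_base_iso_of_isFrobenioid F₁ hF₁)
    (exists_preSteps_of_base_iso F₁ hF₁) (fun A _ f => exists_arrow_over_base F₁ hF₁ A f) h2 E
    (fun A B φ => (hg₂.obj (Ψ.functor.obj A) _).trans (hg₂.obj (Ψ.functor.obj A) _).symm) hdeg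

end FrdI


end Literature.AlgebraicGeometry.Frobenioids

-- build-enqueue re-land 2026-08-26 (abc-iut-L6-t10 on behalf of abc-iut-L1-t14; declarations byte-identical; STRANDED-ACCEPT remedy, cell pattern c312-1 06:28:42Z)
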